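import Summits.BirchSwinnertonDyer.BirchSwinnertonDyer.Theorems.ClassRecordThreeCornerAtThreeShimuraFamilyLevelData
import Summits.BirchSwinnertonDyer.BirchSwinnertonDyer.Theorems.ErratumRoadFiveShimuraKolyvaginOrderBoundInertLocalAll
import Summits.BirchSwinnertonDyer.Rank1Residual.X11b.KolyvaginHlocConcrete
import Literature.NumberTheory.EllipticCurves.HeegnerPointsKolyvaginGoodReductionProofs
import HarnessLib

/-!
# Gross 1991 Prop. 6.2 (1) ∕ McCallum Lemma 4.3 at EVERY finite place `v ∤ m` for the classes of a family of GENERALISED Kolyvagin data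
# on a SHIMURA frame (inert set `S`, the other bad primes split) — x11b3's `KolyvaginHloc.hloc_concrete_of_GZ31` RE-KEYED on
# `JET.KolyvaginFamilyData`, with the receptacle asked ONLY over the bad primes `q ∉ S` ((B6)) and the places over `S` served by shim-p1's (R1)
# (cell `bsd-stepL`, seat `bsd-stepL-corner3-p2` g8 = WIDTH-LEVER lane B; `--supports stmt-BirchSwinnertonDyer-21420 --as helper`)

WHY (PORT MAP (P2) §2 (iii)∕(vii); RULING 47 (4)). The KUMMER part of the walk's Selmer-membership supply (`hselmer`∕`hκSel`: the class of
the derived point lies in `H¹_Kum(K_v, E[p^M])` at every place `v` not over the conductor) is, on `X₀(N)`, bsd-jet's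
`JET.localization_kolyvaginClass_mem_kummerSelmerStructure_of_GZ31` ∘ x11b3's `hloc_concrete_of_GZ31`, whose receptacle input `hGZ` ([GZ86 III (3.1)])
is asked at EVERY bad place of `E/K`. On the frames of the carrier-inert Shimura road the bad primes of `S` (among them `p = 3`) are INERT in `K` and
carry NO E⁰-label, while the bad primes `q ∉ S` split and carry (B6) (`ShimuraCMFamily.LabelB6`, p594740; receptacle form g5's `receptacle_of_labelB6`,
p591819). THIS FILE: `kolyvaginClass_familyData_mem_selmerLocalKer` — for a family `d : (m ∣ n) → KolyvaginFamilyData W K ι m` over a square-free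
top level `n` on Kolyvagin primes of Gross depth `M`, with the weak (B4) label in datum form (`Tr_ℓ y(m) = a_ℓ · y(m∕ℓ)↑` for the datum's `σ_ℓ`), the
receptacle ONLY at the places over the bad primes `q ∉ S` (in the output shape of `receptacle_of_labelB6`), `n′` prime to `p^M`, and admissibility:
`(d m hm).kolyvaginClass hp M ∈ selmerLocalKer (E∕K) K_v (p^M)` at every `m ∣ n` and every finite `v ∤ m`. Proof = x11b3's, on the level data of
`ShimuraWalk.exists_levelData_familyData` (p599103): good `v` — Milne I.3.8 (`kolyvaginClass_mem_selmerLocalKer_of_inertia_of_hasGoodReductionAt`);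
bad `v` over `q ∈ S` — (R1) `kolyvaginClass_mem_selmerLocalKer_of_mem_inertSet` (shim-p1 p464962: `q𝓞_K` splits completely in `K[m]`, no reduction
input); bad `v` over `q ∉ S` — the `E⁰(K̄_v)`-receptacle END `GrossBadPlace.kolyvaginClass_kolyvaginPoint_mem_selmerLocalKer_of_GZ31_E0` with
`E′_m :=` the subgroup generated by the `𝒢_m`-orbits of `y(m)` and of the `y(m∕ℓ)↑`, `Tr_ℓ y(m) ∈ p^M E′_m` from (B4) + (3.3) `p^M ∣ a_ℓ`
(`pow_dvd_frobeniusTrace_of_kolyvaginPrime`); the invariance `hPt` from (B4) (`map_kolyvaginPoint_mem_invPoints`), `hgen` from the datum's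
generators (`le_closure_of_map_zpowers`), `hI` from `KolyvaginH44.smul_kolyvaginPoint_eq_of_mem_localInertia`; a bad place lies over a prime of `N`
(`hasGoodReductionAt_baseChange_of_hasGoodReductionAt_rat`). HONEST FRAMING: one theorem (no definition, no named fact, no `sorry`); CONDITIONAL on
the displayed labels (the receptacle over `q ∉ S` = (B6), beyond print for `X_{N⁺,N⁻}`), `hcop`, `hA`; nothing about any Heegner∕CM point is
constructed; no stub closes; BSD is not proved by any of this; T7. Credit: x11b3 (hloc_concrete, ENDs), shim-p1 g6∕g7 ((R1), inertia), bsd-jet.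
References: [cite: GrossLMS1991, §6 Prop. 6.2 (1) and proof (pp. 244–245), Prop. 3.7 (1), §3 (3.3), Lemma 4.3, §4 (4.1)]
[cite: McCallumLMS1991, Lemma 4.3, §4 (4)–(6)] [cite: GrossZagier1986, III (3.1)] [cite: MilneADT2006, Ch. I Prop. 3.8] [cite: Howard2004Duke, Lemma 3.1.5].
presearch: «Kolyvagin classes of CM points on Shimura curves are Selmer at bad places» → [corpus: GrossLMS1991 Prop. 6.2 (1) p. 245] (X₀(N) via GZ III 3.1);
[corpus: Howard 2004 Duke L3.1.5] (splitting); Nekovář 2007 (5.12) — none for `X_{N⁺,N⁻}` with an inert set (queries of SHIM-T1 §7.5; corpus + galaxy).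
-/

set_option autoImplicit false
set_option linter.dupNamespace false

noncomputable section

open scoped Classical

namespace Summit.BirchSwinnertonDyer.BirchSwinnertonDyer.Theorems.ShimuraWalk

open WeierstrassCurve Field NumberField IsDedekindDomain Finset
  Literature.NumberTheory.EllipticCurves Literature.NumberTheory.GaloisRepresentations
  Literature.NumberTheory.EllipticCurves.KolyvaginCocycle
  Literature.NumberTheory.EllipticCurves.KolyvaginEuler
  Literature.NumberTheory.EllipticCurves.RingClassField
  Literature.NumberTheory.EllipticCurves.ModularForms
  Summit.BirchSwinnertonDyer.Rank1Residual.X11b Summit.BirchSwinnertonDyer.Rank1Residual.X11b.Three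
  Summit.BirchSwinnertonDyer.Rank1Residual.X11b.Three.GrossBadPlace Summit.BirchSwinnertonDyer.Rank1Residual.X11b.KolyvaginHloc
  Summit.BirchSwinnertonDyer.Rank1Residual.JET
  Summit.BirchSwinnertonDyer.BirchSwinnertonDyer.Theorems

variable {K : Type} [Field K] [NumberField K] {W : WeierstrassCurve ℚ}

set_option maxHeartbeats 800000 in
/-- **Gross 1991 Prop. 6.2 (1) at every finite `v ∤ m` for a family of generalised Kolyvagin data on a Shimura frame**; see the module
docstring. [cite: GrossLMS1991, §6 Prop. 6.2 (1), Prop. 3.7 (1), §3 (3.3), Lemma 4.3, §4 (4.1)] [cite: McCallumLMS1991, Lemma 4.3]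
[cite: Howard2004Duke, Lemma 3.1.5] [cite: MilneADT2006, Ch. I Prop. 3.8] -/
theorem kolyvaginClass_familyData_mem_selmerLocalKer {N : ℕ} [NeZero N] [W.IsElliptic] [W.IsGloballyMinimal]
    (hK : IsImaginaryQuadratic K) (ι : K →+* ℂ) (hN : W.conductorNorm ℤ = N)
    {p M : ℕ} (hp : p.Prime) (hM : 1 ≤ M) (Dt : ModularParametrizationData W N)
    {S : Finset ℕ}
    (hin : ∀ ℓ ∈ S, ℓ.Prime ∧ ℓ ∣ N ∧ ¬ ℓ ^ 2 ∣ N ∧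
      ((Ideal.span {(ℓ : ℤ)}).primesOver (𝓞 K)).ncard = 1 ∧ ¬ (ℓ : ℤ) ∣ NumberField.discr K)
    {n : ℕ} (hn : Squarefree n)
    (hKol : ∀ q ∈ n.primeFactors, IsKolyvaginPrime N W K p q ∧ FrobEqFrobInfty W K (p ^ M) q)
    (d : (m : ℕ) → m ∣ n → KolyvaginFamilyData W K ι m)
    (hB4d : ∀ (m : ℕ) (hm : m ∣ n), ∀ (ℓ : ℕ) (hℓ : ℓ ∈ m.primeFactors)
      (hle : ringClassField K ι (m / ℓ) ≤ ringClassField K ι m),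
      ∑ i ∈ Finset.range (ℓ + 1), pointGalHom W (ringClassField K ι m) ((d m hm).σ ℓ ^ i) (d m hm).y =
        W.frobeniusTrace ℓ • WeierstrassCurve.Affine.Point.map (W' := W)
          ((RingClassField.inclusion ι hle).restrictScalars ℚ)
          (d (m / ℓ) ((Nat.div_dvd_of_dvd (Nat.dvd_of_mem_primeFactors hℓ)).trans hm)).y)
    {n' : ℤ} (hcop : IsCoprime ((p ^ M : ℕ) : ℤ) n')
    (hrec : ∀ (q : ℕ), q.Prime → q ∣ N → q ∉ S → ∀ (m : ℕ) (hm : m ∣ n)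
      (γ : ringClassField K ι m ≃ₐ[ℚ] ringClassField K ι m) (v : HeightOneSpectrum (𝓞 K)),
      ((q : ℕ) : 𝓞 K) ∈ v.asIdeal →
        n' • pointsMap (W.baseChange K) (v.adicCompletion K)
            ((d m hm).toGeomPoints (pointGalHom W (ringClassField K ι m) γ (d m hm).y)) ∈
          E0Receptacle (W.baseChange K) v ∧
        ∀ (ℓ : ℕ) (hℓ : ℓ ∈ m.primeFactors)
          (hle : ringClassField K ι (m / ℓ) ≤ ringClassField K ι m),
          n' • pointsMap (W.baseChange K) (v.adicCompletion K)
              ((d m hm).toGeomPoints (pointGalHom W (ringClassField K ι m) γ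
                (WeierstrassCurve.Affine.Point.map (W' := W)
                  ((RingClassField.inclusion ι hle).restrictScalars ℚ)
                  (d (m / ℓ) ((Nat.div_dvd_of_dvd (Nat.dvd_of_mem_primeFactors hℓ)).trans hm)).y))) ∈
            E0Receptacle (W.baseChange K) v)
    (hA : ∀ (m : ℕ) (hm : m ∣ n),
      IsAdmissible (absoluteGaloisGroup K) (d m hm).pointsSubgroup ((p ^ M : ℕ) : ℤ)) :
    ∀ (m : ℕ) (hm : m ∣ n) (v : HeightOneSpectrum (𝓞 K)), (m : 𝓞 K) ∉ v.asIdeal →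
      (d m hm).kolyvaginClass hp M ∈
        selmerLocalKer (W.baseChange K) (v.adicCompletion K) ((p ^ M : ℕ) : ℤ) := by
  intro m hm v hmv
  haveI : Fact p.Prime := ⟨hp⟩
  haveI : (W.baseChange K).IsElliptic := inferInstanceAs (W.map (algebraMap ℚ K)).IsElliptic
  have hn0 : n ≠ 0 := Squarefree.ne_zero hn
  have hm0 : m ≠ 0 := ne_zero_of_dvd_ne_zero hn0 hm
  have hinert : ∀ q ∈ n.primeFactors, (Ideal.span {(q : 𝓞 K)}).IsPrime :=
    fun q hq ↦ (hKol q hq).1.2.2.2.2.1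
  have hmN : ∀ q ∈ m.primeFactors, ¬ q ∣ N := fun q hq ↦ (hKol q (Nat.primeFactors_mono hm hn0 hq)).1.2.1
  have hdiv : ∀ Q : geomPoints (W.baseChange K), ∃ R, ((p ^ M : ℕ) : ℤ) • R = Q :=
    (W.baseChange K).zsmul_geomPoints_surjective_of_charZero
      (by exact_mod_cast pow_ne_zero M hp.ne_zero)
  -- the structures of the level-data package
  letI hcg : ∀ k, CommGroup (ringClassGal ι k) := fun k ↦
    { (inferInstance : Group (ringClassGal ι k)) with
      mul_comm := fun a b ↦ (KolyvaginH44.isMulCommutative_ringClassGal' hK ι k).is_comm.comm a b }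
  letI act : ∀ k, DistribMulAction (ringClassGal ι k)
      ((W.baseChange (ringClassField K ι k)).toAffine.Point) := fun k ↦
    DistribMulAction.compHom _ ((pointGalHom W (ringClassField K ι k)).comp (ringClassGal ι k).subtype)
  -- THE SEAM: level data at every level (`exists_levelData_familyData`)
  choose σ H hF f y π j e hord hj hπρ hfsec hHρ hdict hjunk using
    fun k ↦ exists_levelData_familyData (W := W) hK ι hn hinert d k
  letI hft : ∀ k, Fintype (ringClassGal ι k ⧸ H k) := hF
  have hsmul : ∀ (k) (g : ringClassGal ι k) (Q : (W.baseChange (ringClassField K ι k)).toAffine.Point),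
      g • Q = pointGalHom W (ringClassField K ι k)
        (g : ringClassField K ι k ≃ₐ[ℚ] ringClassField K ι k) Q := fun _ _ _ ↦ rfl
  set ρ : ∀ k, ringClassGal ι k →* (ringClassField K ι k ≃ₐ[ℚ] ringClassField K ι k) :=
    fun k ↦ (ringClassGal ι k).subtype with hρdef
  have hρ : ∀ k, Function.Injective (ρ k) := fun k ↦ (ringClassGal ι k).subtype_injective
  have hj' : ∀ (k) (g : absoluteGaloisGroup K)
      (a : (W.baseChange (ringClassField K ι k)).toAffine.Point),
      j k (π k g • a) = g • j k a := fun k g a ↦ by rw [hsmul]; exact hj k g a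
  have hπρ' : ∀ (k) (τ : absoluteGaloisGroup K) (x : ringClassField K ι k),
      τ • e k x = e k (ρ k (π k τ) x) := fun k τ x ↦ hπρ k τ x
  -- the dictionary at the divisor `m`
  obtain ⟨hjm, hym, hσm, hfS, hem, hPm⟩ := hdict m hm
  have hle : ∀ {ℓ : ℕ}, ℓ ∈ m.primeFactors → ringClassField K ι (m / ℓ) ≤ ringClassField K ι m :=
    fun hℓ ↦ ringClassField_mono hK ι (Nat.div_dvd_of_dvd (Nat.dvd_of_mem_primeFactors hℓ)) hm0
  have hm' : ∀ {ℓ : ℕ}, ℓ ∈ m.primeFactors → m / ℓ ∣ n := fun hℓ ↦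
    (Nat.div_dvd_of_dvd (Nat.dvd_of_mem_primeFactors hℓ)).trans hm
  -- (B4) ∧ (3.3): `Tr_ℓ y(m) = a_ℓ • y(m/ℓ)↑` with `p^M ∣ a_ℓ`
  have hrel : ∀ ℓ ∈ m.primeFactors, ∀ (hℓ : ℓ ∈ m.primeFactors),
      grAct ((W.baseChange (ringClassField K ι m)).toAffine.Point) (traceElt (σ m ℓ) ℓ) (y m) =
        W.frobeniusTrace ℓ • WeierstrassCurve.Affine.Point.map (W' := W)
          ((RingClassField.inclusion ι (hle hℓ)).restrictScalars ℚ) (d (m / ℓ) (hm' hℓ)).y := by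
    intro ℓ _ hℓ
    rw [grAct_traceElt, hym, ← hB4d m hm ℓ hℓ (hle hℓ)]
    refine Finset.sum_congr rfl fun i _ ↦ ?_
    rw [hsmul, Subgroup.coe_pow, hσm ℓ hℓ]
  have haℓ : ∀ ℓ ∈ m.primeFactors, ((p ^ M : ℕ) : ℤ) ∣ W.frobeniusTrace ℓ := fun ℓ hℓ ↦
    pow_dvd_frobeniusTrace_of_kolyvaginPrime (K := K) Dt hp hM (hKol ℓ (Nat.primeFactors_mono hm hn0 hℓ)).1
      (hKol ℓ (Nat.primeFactors_mono hm hn0 hℓ)).2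
  have htrA : ∀ ℓ ∈ m.primeFactors,
      grAct ((W.baseChange (ringClassField K ι m)).toAffine.Point) (traceElt (σ m ℓ) ℓ) (y m) ∈
        zsmulRange ((W.baseChange (ringClassField K ι m)).toAffine.Point) ((p ^ M : ℕ) : ℤ) :=
    fun ℓ hℓ ↦ grAct_traceElt_mem_of_eq_smul (hrel ℓ hℓ hℓ) (haℓ ℓ hℓ)
  -- `hgen`, `hdvd`, `hA`, `hPt`, `hI` at level `m`, abstract currency
  have hgen : H m ≤ Subgroup.closure (σ m '' (m.primeFactors : Set ℕ)) :=
    le_closure_of_map_zpowers hK ι (hn.squarefree_of_dvd hm) (σ m) (H m) (ρ m) (hρ m)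
      (fun q hq ↦ by
        rw [MonoidHom.map_zpowers]
        change Subgroup.zpowers (σ m q : ringClassField K ι m ≃ₐ[ℚ] ringClassField K ι m) = _
        rw [hσm q hq]; exact (d m hm).zpowers_σ q hq)
      (hHρ m)
  have hdvd : ∀ ℓ ∈ m.primeFactors, ((p ^ M : ℕ) : ℤ) ∣ ((ℓ + 1 : ℕ) : ℤ) := by
    intro ℓ hℓ
    obtain ⟨hℓK, hℓM⟩ := hKol ℓ (Nat.primeFactors_mono hm hn0 hℓ)
    exact (IsKolyvaginPrime.pow_dvd_add_one W hp hℓK hM hℓM).1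
  have hA' : IsAdmissible (absoluteGaloisGroup K) (j m).range ((p ^ M : ℕ) : ℤ) := by
    rw [hjm]; exact hA m hm
  have hPt' : j m (kolyvaginPoint (σ m) m.primeFactors (f m) (y m)) ∈
      invPoints (absoluteGaloisGroup K) (j m).range ((p ^ M : ℕ) : ℤ) :=
    map_kolyvaginPoint_mem_invPoints (hfsec m) hgen (hord m) hdvd htrA (π m) (j m) (hj' m)
  obtain ⟨𝔐, h𝔐⟩ := v.localPrimesAbove_nonempty
  have hI' : ∀ t ∈ 𝔐.inertia (absoluteGaloisGroup (v.adicCompletion K)),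
      resGal (K := K) (v.adicCompletion K) t • j m (kolyvaginPoint (σ m) m.primeFactors (f m) (y m)) =
        j m (kolyvaginPoint (σ m) m.primeFactors (f m) (y m)) :=
    KolyvaginH44.smul_kolyvaginPoint_eq_of_mem_localInertia (W := W) hK ι σ
      (fun k ↦ k.primeFactors) H f y π j hj' e ρ hρ hπρ' m v hmv 𝔐 h𝔐
  have hrat : ∀ Φ : absoluteGaloisGroup K, (∀ x : ringClassField K ι m, Φ • e m x = e m x) →
      Φ • j m (kolyvaginPoint (σ m) m.primeFactors (f m) (y m)) =
        j m (kolyvaginPoint (σ m) m.primeFactors (f m) (y m)) :=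
    KolyvaginH44.hrat_of_galoisDictionary ι σ (fun k ↦ k.primeFactors) H f y π j hj' e ρ hρ hπρ' m hm0
  -- the abstract class IS the datum's class `c_M(m)`
  have hP : j m (kolyvaginPoint (σ m) m.primeFactors (f m) (y m)) =
      (d m hm).toGeomPoints (d m hm).derivedPoint := by rw [hjm, hPm]
  have hPt : (d m hm).toGeomPoints (d m hm).derivedPoint ∈
      invPoints (absoluteGaloisGroup K) (d m hm).pointsSubgroup ((p ^ M : ℕ) : ℤ) := by
    have h := hPt'
    rw [hP, hjm] at h
    exact h
  have hc : (d m hm).kolyvaginClass hp M =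
      kolyvaginClass (W.baseChange K) ((p ^ M : ℕ) : ℤ) hdiv hA'
        (j m (kolyvaginPoint (σ m) m.primeFactors (f m) (y m))) hPt' := by
    rw [KolyvaginFamilyData.kolyvaginClass_def, dif_pos ⟨hA m hm, hPt⟩]
    exact KolyvaginH44.kolyvaginClass_congr (by rw [hjm]; rfl) hP.symm
  rw [hc]
  -- Gross Prop. 6.2 (1) by the reduction type of `E/K` at `v`
  by_cases hgood : (W.baseChange K).HasGoodReductionAt v
  · exact kolyvaginClass_mem_selmerLocalKer_of_inertia_of_hasGoodReductionAt (W.baseChange K) hA'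
      hPt' v hgood h𝔐 hI'
  -- bad `v` lies over a prime `q ∣ N`
  set u : HeightOneSpectrum (𝓞 ℚ) := v.under (𝓞 ℚ) with hudef
  set q : ℕ := (Rat.HeightOneSpectrum.primesEquiv u : ℕ) with hqdef
  have hqP : q.Prime := (Rat.HeightOneSpectrum.primesEquiv u).2
  have hqu : (q : 𝓞 ℚ) ∈ u.asIdeal :=
    (natCast_mem_asIdeal_iff_eq_primesEquiv_symm u hqP).mpr (Equiv.symm_apply_apply _ u).symm
  have hqv : ((q : ℕ) : 𝓞 K) ∈ v.asIdeal := by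
    have h1 : (q : 𝓞 ℚ) ∈ v.asIdeal.under (𝓞 ℚ) := hqu
    rw [Ideal.under_def, Ideal.mem_comap, map_natCast] at h1
    exact h1
  have hqN : q ∣ N := by
    by_contra hqN
    haveI : v.asIdeal.LiesOver u.asIdeal := ⟨rfl⟩
    exact hgood (hasGoodReductionAt_baseChange_of_hasGoodReductionAt_rat W u v
      (hasGoodReductionAt_of_not_dvd_conductorNorm W u (by rw [hN]; exact hqN)))
  by_cases hqS : q ∈ S
  · -- (R1): `v = q𝓞_K` splits completely in `K[m]`
    exact kolyvaginClass_mem_selmerLocalKer_of_mem_inertSet hK ι hm0 (e m) hin hmN hqS hqv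
      (W.baseChange K) hA' hPt' hrat
  -- the `E⁰(K̄_v)`-receptacle END over `q ∉ S`
  set Sg : Set ((W.baseChange (ringClassField K ι m)).toAffine.Point) :=
    {x | ∃ γ : ringClassGal ι m, x = γ • (d m hm).y ∨ ∃ (ℓ : ℕ) (hℓ : ℓ ∈ m.primeFactors),
      x = γ • WeierstrassCurve.Affine.Point.map (W' := W)
        ((RingClassField.inclusion ι (hle hℓ)).restrictScalars ℚ) (d (m / ℓ) (hm' hℓ)).y}
    with hSgdef
  have hSstab : ∀ (g : ringClassGal ι m), ∀ s ∈ Sg, g • s ∈ Sg := by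
    rintro g s ⟨γ, h | ⟨ℓ, hℓ, h⟩⟩
    · refine ⟨g * γ, Or.inl ?_⟩
      rw [h]; exact (mul_smul g γ _).symm
    · refine ⟨g * γ, Or.inr ⟨ℓ, hℓ, ?_⟩⟩
      rw [h]; exact (mul_smul g γ _).symm
  have hyS : y m ∈ Sg := by
    rw [hym]; exact ⟨1, Or.inl (one_smul _ _).symm⟩
  have hzS : ∀ (ℓ : ℕ) (hℓ : ℓ ∈ m.primeFactors),
      WeierstrassCurve.Affine.Point.map (W' := W)
        ((RingClassField.inclusion ι (hle hℓ)).restrictScalars ℚ) (d (m / ℓ) (hm' hℓ)).y ∈ Sg :=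
    fun ℓ hℓ ↦ ⟨1, Or.inr ⟨ℓ, hℓ, (one_smul _ _).symm⟩⟩
  have hrecS : ∀ s ∈ Sg, n' • pointsMap (W.baseChange K) (v.adicCompletion K) (j m s) ∈
      E0Receptacle (W.baseChange K) v := by
    rintro s ⟨γ, h | ⟨ℓ, hℓ, h⟩⟩
    · rw [h, hjm, hsmul]
      exact (hrec q hqP hqN hqS m hm γ v hqv).1
    · rw [h, hjm, hsmul]
      exact (hrec q hqP hqN hqS m hm γ v hqv).2 ℓ hℓ (hle hℓ)
  have htr : ∀ ℓ ∈ m.primeFactors,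
      grAct ((W.baseChange (ringClassField K ι m)).toAffine.Point) (traceElt (σ m ℓ) ℓ) (y m) ∈
        (AddSubgroup.closure Sg).map (zsmulAddGroupHom ((p ^ M : ℕ) : ℤ) :
          (W.baseChange (ringClassField K ι m)).toAffine.Point →+ _) := by
    intro ℓ hℓ
    obtain ⟨k, hk⟩ := haℓ ℓ hℓ
    refine AddSubgroup.mem_map.mpr ⟨k • WeierstrassCurve.Affine.Point.map (W' := W)
        ((RingClassField.inclusion ι (hle hℓ)).restrictScalars ℚ) (d (m / ℓ) (hm' hℓ)).y,
      AddSubgroup.zsmul_mem _ (AddSubgroup.subset_closure (hzS ℓ hℓ)) k, ?_⟩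
    rw [zsmulAddGroupHom_apply, smul_smul, ← hk, hrel ℓ hℓ hℓ]
  exact kolyvaginClass_kolyvaginPoint_mem_selmerLocalKer_of_GZ31_E0 (W.baseChange K) (hfsec m)
    hgen (hord m) hdvd (π m) (j m) (hj' m) hA' hPt' v h𝔐 hI'
    (E' := AddSubgroup.closure Sg) (n' := n')
    ⟨fun γ e he ↦ smul_mem_closure_of_forall_smul_mem hSstab γ he,
      AddSubgroup.subset_closure hyS, htr,
      fun x hx ↦ zsmul_map_mem_of_mem_closure
        ((pointsMap (W.baseChange K) (v.adicCompletion K)).comp (j m))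
        (E0Receptacle (W.baseChange K) v) n' hrecS hx⟩
    hcop

end Summit.BirchSwinnertonDyer.BirchSwinnertonDyer.Theorems.ShimuraWalk

end
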